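import Literature.Probability.RandomPlanarGeometry.YangBaxterSAWHeading
import Literature.Barriers.CriticalPhenomena.PlaquetteWalkHoleRootFarCellLaw
import HarnessLib

/-!
# Barrier catalogue (SAWScalingLimit): the SECTOR FORM of the class term of a wound excursion at an ARBITRARY cell
of a hole root — eight possible directions per pattern

For a hole root in the `W`-normalisation (root = the `W` side of `w`, the plaquette `(w.1 − 1, w.2)` across it not
in the domain) and a class-`B2a` walk at ANY rooted plaquette `r` with non-empty prefix, the HEADING LAW
(`YangBaxterSAWHeading`: `ΩG.WP_eq_headIn_of_W_root`) gives `WP(θ) = τ(z₀) + 2πk` with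
`τ(z₀) = headIn z₀ + (θ − π/2)·𝟙[z₀ slanted]` and an integer SECTOR `k`. Feeding this into the catalogue's class-term
dichotomy (`ΩG.classTerm_dichotomy`, `PlaquetteWalkHoleRootFarCellLaw`):

* `phase_two_pi_mul_int` — `phase(2πk) = e^{−i·5πk/4}`, and `phase_sixteen_pi` — `phase(2π·8) = 1`: the sector enters
  the class term through an EIGHTH root of unity `ζ^k`, `ζ = e^{−i5π/4}`;
* ★★ `ΩG.phase_WP_eq_of_W_root` — `phase(WP(θ)) = phase(τ(z₀))·phase(2πk)`;
* ★★★ `ΩG.classTerm_sector_form` — for every WOUND class-`B2a` walk at every cell: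
  `classTerm(θ) = ext(θ)·[phase(τ(z₀))·ε(z₀; z₁, z₂)·backBracket(θ; z₀, z₁, z₂, z₃)]·phase(2πk)` — the bracket is the
  walk's «sector-zero direction», an explicit function of `(θ, z₀, z₁, z₂)` alone through the catalogue's twelve
  `backBracket` closed forms; the lane's per-cell direction tables at the ring (#400, #401, banked RING LAWS) are this
  bracket times the fixed power `ζ^{k(cell, z₀)}` pinned by turning rigidity, and at cells beyond the ring (where the
  sector is NOT pinned — HOME `FINDING-YB-SECOND-RING-SECTORS`) the cell sum splits into at most eight directions
  per pattern.

Elementary given the two parents; recorded as the conceptual form of every cell law of the lane (venture «pcv-sawmu»,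
b-step0 gen 20). References: A. Glazman, I. Manolescu, arXiv:1708.00395v3, §2.1 and Lemma 2.1 [GlazmanManolescu2019];
A. Glazman, Electron. Commun. Probab. 20 (2015) no. 86, Lemma 3.1 [Glazman2015WeightedSAW].
-/

noncomputable section

namespace Literature.Probability.RandomPlanarGeometry.SAW.YangBaxter

open Real Complex

/-! ## The sector unit -/

/-- `phase(2πk) = e^{−i·5πk/4}`: a full extra turn of the prefix multiplies the class term by the eighth root of unity
`ζ = e^{−i5π/4}` (spin `σ = 5/8`). [cite: GlazmanManolescu2019, §2.1 (the parafermionic weight e^{−iσ wind}, σ = 5/8)] -/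
theorem phase_two_pi_mul_int (k : ℤ) :
    phase (2 * π * k) = Complex.exp ((-(5 * π * k / 4) : ℝ) * Complex.I) := by
  rw [phase]; congr 2; push_cast; ring

/-- Eight extra turns are invisible: `phase(2π·8) = 1`. [cite: GlazmanManolescu2019, §2.1 (σ = 5/8)] -/
theorem phase_sixteen_pi : phase (2 * π * (8 : ℤ)) = 1 := by
  rw [phase_two_pi_mul_int]
  have : ((-(5 * π * ((8 : ℤ) : ℝ) / 4) : ℝ) : ℂ) * Complex.I = (-5 : ℤ) * (2 * π * Complex.I) := by push_cast; ring
  rw [this, Complex.exp_int_mul_two_pi_mul_I]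

namespace ΩG

variable {D : Set Face} {w r : Face}

/-- ★★ **The phase of the prefix turning, sector form**: for a class-`B2a` walk at any rooted plaquette of a
`W`-normalised hole root, `phase(WP(θ)) = phase(headIn z₀ + (θ − π/2)·𝟙[z₀ slanted])·phase(2πk)` for an integer `k`.
[cite: GlazmanManolescu2019, §2.1, eq. (2.1) and Lemma 2.1 (proof: [Gl])] -/
theorem phase_WP_eq_of_W_root (hh : ((w.1 - 1, w.2) : Face) ∉ D) (ω : ΩG D (w.side .W) r) (h : ω.IsB2a)
    (h0 : 0 < ω.2.firstHitG) (θ : ℝ) :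
    ∃ k : ℤ, phase (ω.WP fun _ => θ) =
      phase (ω.2.firstSideG.headIn + (θ - π / 2) * ω.2.firstSideG.slantInd) * phase (2 * π * k) := by
  obtain ⟨k, hk⟩ := ω.WP_eq_headIn_of_W_root hh h h0 θ
  exact ⟨k, by rw [hk, phase_add]⟩

/-- ★★★ **SECTOR FORM OF THE CLASS TERM, at an arbitrary cell.** For a WOUND class-`B2a` walk `ω` at any rooted
plaquette `r` of a `W`-normalised hole root (non-empty prefix): `classTerm(θ) = ext(θ)·[phase(τ(z₀))·ε(z₀;z₁,z₂)·
backBracket(θ; z₀,z₁,z₂,z₃)]·phase(2πk)` with `τ(z₀) = headIn z₀ + (θ − π/2)·𝟙[z₀ slanted]` and an integer `k` (the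
sector of the prefix); the bracket depends on `(θ, z₀, z₁, z₂)` only. [cite: GlazmanManolescu2019, Lemma 2.1 (statement, "in the form given in [Gl]")]
[cite: Glazman2015WeightedSAW, Lemma 3.1 (proof, pp. 6–7: the classes of walks through a rhombus)] -/
theorem classTerm_sector_form (hh : ((w.1 - 1, w.2) : Face) ∉ D) (ω : ΩG D (w.side .W) r)
    (hr : RootedFace D (w.side .W) r) (h : ω.IsB2a) (h0 : 0 < ω.2.firstHitG) (θ : ℝ)
    (hW : ω.WE (fun _ => θ) ≠ excursionWinding θ ω.2.firstSideG (ω.z1 hr h) ω.1) :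
    ∃ k : ℤ, ω.classTerm (fun _ => θ) hr =
      (ω.2.extWeight (fun _ => θ) r : ℂ) *
        (phase (ω.2.firstSideG.headIn + (θ - π / 2) * ω.2.firstSideG.slantInd) *
          (chordSign ω.2.firstSideG (ω.z1 hr h) ω.1 : ℂ) *
            backBracket θ ω.2.firstSideG (ω.z1 hr h) ω.1 (ω.z₃ hr h)) *
        phase (2 * π * k) := by
  obtain ⟨k, hk⟩ := ω.phase_WP_eq_of_W_root hh h h0 θ
  rcases ω.classTerm_dichotomy hr h θ with ⟨hWE, -⟩ | ⟨-, hct⟩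
  · exact absurd hWE hW
  · exact ⟨k, by rw [hct, hk]; ring⟩

/-- **Unwound or sector form** (the dichotomy restated): at any cell of a `W`-normalised hole root, a class-`B2a` walk
with non-empty prefix either is unwound with class term `0`, or is wound with class term in sector form.
[cite: GlazmanManolescu2019, Lemma 2.1 (statement, "in the form given in [Gl]")] [cite: Glazman2015WeightedSAW, Lemma 3.1 (proof, pp. 6–7)] -/
theorem classTerm_zero_or_sector_form (hh : ((w.1 - 1, w.2) : Face) ∉ D) (ω : ΩG D (w.side .W) r)
    (hr : RootedFace D (w.side .W) r) (h : ω.IsB2a) (h0 : 0 < ω.2.firstHitG) (θ : ℝ) :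
    ω.classTerm (fun _ => θ) hr = 0 ∨
      ∃ k : ℤ, ω.classTerm (fun _ => θ) hr =
        (ω.2.extWeight (fun _ => θ) r : ℂ) *
          (phase (ω.2.firstSideG.headIn + (θ - π / 2) * ω.2.firstSideG.slantInd) *
            (chordSign ω.2.firstSideG (ω.z1 hr h) ω.1 : ℂ) *
              backBracket θ ω.2.firstSideG (ω.z1 hr h) ω.1 (ω.z₃ hr h)) *
          phase (2 * π * k) := by
  rcases ω.classTerm_dichotomy hr h θ with ⟨-, h0'⟩ | ⟨hW, -⟩
  · exact Or.inl h0'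
  · exact Or.inr (ω.classTerm_sector_form hh hr h h0 θ hW)

end ΩG

end Literature.Probability.RandomPlanarGeometry.SAW.YangBaxter

end
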